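import Mathlib.Analysis.SpecialFunctions.Gaussian.FourierTransform
import Mathlib.Analysis.SpecialFunctions.Pow.Deriv
import Mathlib.Analysis.Calculus.ParametricIntegral
import Mathlib.MeasureTheory.Integral.IntegralEqImproper
import HarnessLib

/-!
# The Gaussian Mellin cutoff `W(x) = (1/2πi) ∫_{(c)} e^{u²} x^{−u} du/u = ½ erfc(½ log x)`

Topic `Literature/Analysis/SpecialFunctions`. Definitions with bodies and theorems; everything is
PROVED, there are no named facts.

Smoothed ("approximate functional equation with smooth weights") moment computations for `ζ` and
`L`-functions start from Mellin inversion against a kernel `G(u)/u` with `G` entire, even, `G(0) = 1`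
and of rapid decay in vertical strips (Iwaniec–Kowalski, *Analytic Number Theory*, Thm. 5.3 and
(5.13)–(5.14); M. P. Young, *A short proof of Levinson's theorem*, Arch. Math. 95 (2010), §3;
the standard choice `G(u) = e^{u²}`). The cutoff
`V(y) = (1/2πi) ∫_{(3)} y^{−u} G(u) du/u` is smooth, `= 1 + O(y^{A})` as `y → 0`, `≪ y^{−A}` as
`y → ∞`, and the contour may be moved across `u = 0` at the cost of the residue `G(0) = 1`.
For `G(u) = e^{u²}` all of this is explicit: the kernel on the line `Re u = c`,

  `K_c(x) = (1/2π) ∫_ℝ e^{(c+iy)²} x^{−(c+iy)} dy/(c+iy)`   (`GaussMellin.kernel c x`),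

equals the complementary error function `W(x) = ½ erfc(½ log x) = (1/(2√π)) ∫_{log x}^∞ e^{−τ²/4} dτ`
(`GaussMellin.gaussCutoff`) for `c > 0`, and `W(x) − 1` for `c < 0`. We prove this without contour
integration: `∂_x` of the integrand has no pole (`∂_x x^{−u}/u = −x^{−u−1}`), the resulting Gaussian
integral is `∫_ℝ e^{(c+iy)²} x^{−(c+iy)} dy = √π e^{−(log x)²/4}` for *every* `c`
(`integral_cexp_sq_mul_cpow_neg`, completing the square with Mathlib's `integral_cexp_quadratic`),
so `K_c'(x) = W'(x) = −e^{−(log x)²/4}/(2√π x)` on `(0, ∞)` (`hasDerivAt_kernel`, differentiation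
under the integral sign), and the constants of integration are fixed by `K_c(x) → 0` as `x → ∞`
(`c > 0`), resp. `x → 0⁺` (`c < 0`) (`norm_kernel_le`: `‖K_c(x)‖ ≤ e^{c²} x^{−c}/(2√π|c|)`).

## Main results

* `GaussMellin.kernel_eq_gaussCutoff` (`c > 0`), `GaussMellin.kernel_eq_gaussCutoff_sub_one`
  (`c < 0`), `GaussMellin.kernel_sub_kernel_eq_one` (the residue `1` at `u = 0`);
* `GaussMellin.gaussCutoff_one` (`W(1) = ½`), `GaussMellin.gaussCutoff_add_gaussCutoff_inv`
  (`W(x) + W(1/x) = 1`), `GaussMellin.hasDerivAt_gaussCutoff`, `GaussMellin.gaussCutoff_mem_Icc`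
  (`0 ≤ W ≤ 1`), `GaussMellin.tendsto_gaussCutoff_atTop`, `…_nhdsWithin_zero`;
* decay: `GaussMellin.gaussCutoff_nonneg_le` (`W(x) ≤ ½e^{−(log x)²/4}`, `x ≥ 1`),
  `GaussMellin.one_sub_gaussCutoff_nonneg_le` (`1 − W(x) ≤ ½e^{−(log x)²/4}`, `x ≤ 1`), and the
  polynomial forms `GaussMellin.gaussCutoff_le_rpow` (`W(x) ≤ ½e^{A²}x^{−A}`),
  `GaussMellin.one_sub_gaussCutoff_le_rpow` (`1 − W(x) ≤ ½e^{A²}x^{A}`), for every real `A`.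

This is the first brick (the Mellin cutoff) of a smoothed evaluation of the mollified second moment
in Levinson's method (`Literature/NumberTheory/LFunctions/LevinsonMethodConditional.lean`).

## References

* H. Iwaniec, E. Kowalski, *Analytic Number Theory*, AMS Colloquium Publ. 53 (2004), §5.2,
  Thm. 5.3, (5.13)–(5.14). [IwaniecKowalski2004]
* M. P. Young, *A short proof of Levinson's theorem*, Arch. Math. 95 (2010), 539–548, §3. [Young2010]
-/

noncomputable section

open Complex Real MeasureTheory Set Filter Topology

namespace Literature.Analysis.SpecialFunctions

namespace GaussMellin

/-! ### The Gaussian integral on the vertical line `Re u = c` -/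

/-- For `x > 0` and `u = c + iy`: `x^{-u} = exp(−u log x)` with the real logarithm. [folklore] -/
theorem ofReal_cpow_neg (x : ℝ) (hx : 0 < x) (u : ℂ) :
    (x : ℂ) ^ (-u) = cexp (-u * (Real.log x : ℂ)) := by
  rw [Complex.cpow_def_of_ne_zero (by exact_mod_cast hx.ne'), ← Complex.ofReal_log hx.le]
  ring_nf

/-- **`∫_ℝ e^{(c+iy)²} x^{−(c+iy)} dy = √π · e^{−(log x)²/4}`** for `x > 0` and every real `c`
(complete the square: `(c+iy)² − (c+iy)ℓ = (c² − cℓ) + i(2c − ℓ)y − y²`, `ℓ = log x`).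
[folklore] -/
theorem integral_cexp_sq_mul_cpow_neg (c : ℝ) {x : ℝ} (hx : 0 < x) :
    ∫ y : ℝ, cexp (((c : ℂ) + y * I) ^ 2) * (x : ℂ) ^ (-((c : ℂ) + y * I)) =
      ((Real.sqrt π * Real.exp (-(Real.log x) ^ 2 / 4) : ℝ) : ℂ) := by
  set ℓ : ℝ := Real.log x with hℓ
  have hfun : ∀ y : ℝ, cexp (((c : ℂ) + y * I) ^ 2) * (x : ℂ) ^ (-((c : ℂ) + y * I)) =
      cexp ((-1 : ℂ) * (y : ℂ) ^ 2 + (((2 * c - ℓ : ℝ) : ℂ) * I) * y + ((c ^ 2 - c * ℓ : ℝ) : ℂ)) := by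
    intro y
    rw [ofReal_cpow_neg x hx, ← Complex.exp_add]
    congr 1
    have hI : I * I = -1 := Complex.I_mul_I
    push_cast
    linear_combination ((y : ℂ) ^ 2) * hI
  simp_rw [hfun]
  rw [integral_cexp_quadratic (by simp) _ _]
  have h1 : ((π : ℂ) / -(-1 : ℂ)) ^ (1 / 2 : ℂ) = ((Real.sqrt π : ℝ) : ℂ) := by
    rw [neg_neg, div_one, Real.sqrt_eq_rpow, Complex.ofReal_cpow Real.pi_pos.le]
    norm_num
  have hexp : (((c ^ 2 - c * ℓ : ℝ) : ℂ)) - ((((2 * c - ℓ : ℝ) : ℂ)) * I) ^ 2 / (4 * (-1 : ℂ)) =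
      (((-(Real.log x) ^ 2 / 4 : ℝ)) : ℂ) := by
    have hI : I * I = -1 := Complex.I_mul_I
    rw [hℓ]
    push_cast
    field_simp
    linear_combination ((2 * (c : ℂ) - Real.log x) ^ 2) * hI
  rw [h1, hexp, Complex.ofReal_mul, Complex.ofReal_exp]

/-! ### The kernel on the line `Re u = c`, `c ≠ 0` -/

/-- The integrand `e^{u²} x^{-u}/u`, `u = c + iy`. [folklore] -/
def kernelIntegrand (c x y : ℝ) : ℂ :=
  cexp (((c : ℂ) + y * I) ^ 2) * (x : ℂ) ^ (-((c : ℂ) + y * I)) / ((c : ℂ) + y * I)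

/-- **The Gaussian Mellin kernel on the line `Re u = c`**:
`K_c(x) = (1/2π) ∫_ℝ e^{(c+iy)²} x^{−(c+iy)} /(c+iy) dy` (`= (1/2πi) ∫_{(c)} e^{u²} x^{-u} du/u`). [folklore] -/
def kernel (c x : ℝ) : ℂ := (1 / (2 * π) : ℂ) * ∫ y : ℝ, kernelIntegrand c x y

/-- `‖c + iy‖ ≥ |c|`. [folklore] -/
theorem abs_le_norm_add_mul_I (c y : ℝ) : |c| ≤ ‖(c : ℂ) + y * I‖ := by
  have := Complex.abs_re_le_norm ((c : ℂ) + y * I)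
  simpa using this

/-- `‖e^{(c+iy)²}‖ = e^{c² − y²}`. [folklore] -/
theorem norm_cexp_sq (c y : ℝ) : ‖cexp (((c : ℂ) + y * I) ^ 2)‖ = Real.exp (c ^ 2 - y ^ 2) := by
  rw [Complex.norm_exp]
  congr 1
  have hI : I * I = -1 := Complex.I_mul_I
  have : ((c : ℂ) + y * I) ^ 2 = ((c ^ 2 - y ^ 2 : ℝ) : ℂ) + ((2 * c * y : ℝ) : ℂ) * I := by
    push_cast; linear_combination ((y : ℂ) ^ 2) * hI
  rw [this, Complex.add_re, Complex.ofReal_re, Complex.re_ofReal_mul, Complex.I_re, mul_zero, add_zero]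

/-- `‖x^{−(c+iy)}‖ = x^{−c}` for `x > 0`. [folklore] -/
theorem norm_cpow_neg (c y : ℝ) {x : ℝ} (hx : 0 < x) :
    ‖(x : ℂ) ^ (-((c : ℂ) + y * I))‖ = x ^ (-c) := by
  rw [Complex.norm_cpow_eq_rpow_re_of_pos hx]
  simp

/-- Pointwise bound: `‖e^{u²} x^{-u}/u‖ ≤ (e^{c²} x^{-c}/|c|) e^{-y²}` (`c ≠ 0`, `x > 0`). [folklore] -/
theorem norm_kernelIntegrand_le {c : ℝ} (hc : c ≠ 0) {x : ℝ} (hx : 0 < x) (y : ℝ) :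
    ‖kernelIntegrand c x y‖ ≤ Real.exp (c ^ 2) * x ^ (-c) / |c| * Real.exp (-y ^ 2) := by
  rw [kernelIntegrand, norm_div, norm_mul, norm_cexp_sq, norm_cpow_neg c y hx]
  have hcpos : 0 < |c| := abs_pos.2 hc
  have hden := abs_le_norm_add_mul_I c y
  calc Real.exp (c ^ 2 - y ^ 2) * x ^ (-c) / ‖(c : ℂ) + y * I‖
      ≤ Real.exp (c ^ 2 - y ^ 2) * x ^ (-c) / |c| :=
        div_le_div_of_nonneg_left (by positivity) hcpos hden
    _ = _ := by rw [Real.exp_sub, Real.exp_neg]; field_simp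

/-- The integrand is continuous in `y`. [folklore] -/
theorem continuous_kernelIntegrand {c : ℝ} (hc : c ≠ 0) (x : ℝ) (hx : 0 < x) :
    Continuous fun y : ℝ => kernelIntegrand c x y := by
  unfold kernelIntegrand
  have hne : ∀ y : ℝ, (c : ℂ) + y * I ≠ 0 := fun y h => by
    have := congrArg Complex.re h; simp at this; exact hc this
  refine Continuous.div ?_ (by fun_prop) hne
  refine Continuous.mul (by fun_prop) ?_
  simp_rw [ofReal_cpow_neg x hx]
  fun_prop

/-- The integrand is integrable in `y`. [folklore] -/
theorem integrable_kernelIntegrand {c : ℝ} (hc : c ≠ 0) {x : ℝ} (hx : 0 < x) :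
    Integrable fun y : ℝ => kernelIntegrand c x y := by
  refine Integrable.mono' ((integrable_exp_neg_mul_sq zero_lt_one).const_mul
    (Real.exp (c ^ 2) * x ^ (-c) / |c|)) (continuous_kernelIntegrand hc x hx).aestronglyMeasurable
    (Eventually.of_forall fun y => ?_)
  have := norm_kernelIntegrand_le hc hx y
  simpa [one_mul] using this

/-- **Size of the kernel**: `‖K_c(x)‖ ≤ (e^{c²}/(2√π |c|)) x^{-c}` (`c ≠ 0`, `x > 0`). [folklore] -/
theorem norm_kernel_le {c : ℝ} (hc : c ≠ 0) {x : ℝ} (hx : 0 < x) :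
    ‖kernel c x‖ ≤ Real.exp (c ^ 2) / (2 * Real.sqrt π * |c|) * x ^ (-c) := by
  rw [kernel, norm_mul]
  have h1 : ‖(1 / (2 * π) : ℂ)‖ = 1 / (2 * π) := by
    rw [show (1 / (2 * π) : ℂ) = ((1 / (2 * π) : ℝ) : ℂ) by push_cast; ring, Complex.norm_real,
      Real.norm_of_nonneg (by positivity)]
  rw [h1]
  have h2 : ‖∫ y : ℝ, kernelIntegrand c x y‖ ≤ Real.exp (c ^ 2) * x ^ (-c) / |c| * Real.sqrt π := by
    calc ‖∫ y : ℝ, kernelIntegrand c x y‖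
        ≤ ∫ y : ℝ, Real.exp (c ^ 2) * x ^ (-c) / |c| * Real.exp (-1 * y ^ 2) :=
          norm_integral_le_of_norm_le ((integrable_exp_neg_mul_sq zero_lt_one).const_mul _)
            (Eventually.of_forall fun y => by
              simpa [neg_mul, one_mul] using norm_kernelIntegrand_le hc hx y)
      _ = Real.exp (c ^ 2) * x ^ (-c) / |c| * Real.sqrt π := by
          rw [integral_const_mul, integral_gaussian 1, div_one]
  calc 1 / (2 * π) * ‖∫ y : ℝ, kernelIntegrand c x y‖ ≤ 1 / (2 * π) * (Real.exp (c ^ 2) * x ^ (-c) / |c| * Real.sqrt π) :=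
        mul_le_mul_of_nonneg_left h2 (by positivity)
    _ = Real.exp (c ^ 2) / (2 * Real.sqrt π * |c|) * x ^ (-c) := by
        have hπ : Real.sqrt π * Real.sqrt π = π := Real.mul_self_sqrt Real.pi_pos.le
        have hs : 0 < Real.sqrt π := Real.sqrt_pos.2 Real.pi_pos
        field_simp
        nlinarith [hπ]

/-! ### The derivative of the kernel in `x` -/

/-- The integrand in exponential form (for `x > 0`): `e^{u²} e^{−u log x}/u`. [folklore] -/
theorem kernelIntegrand_eq_exp {c x : ℝ} (hx : 0 < x) (y : ℝ) :
    kernelIntegrand c x y =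
      cexp (((c : ℂ) + y * I) ^ 2) * cexp (-((c : ℂ) + y * I) * (Real.log x : ℂ)) / ((c : ℂ) + y * I) := by
  rw [kernelIntegrand, ofReal_cpow_neg x hx]

/-- **`K_c'(x) = −e^{−(log x)²/4}/(2√π x)`** for `c ≠ 0`, `x > 0` (differentiation under the integral
sign, the factor `1/u` cancelling against `∂_x x^{-u} = −u x^{-u-1}`, and the Gaussian integral
`integral_cexp_sq_mul_cpow_neg`). [folklore] -/
theorem hasDerivAt_kernel {c : ℝ} (hc : c ≠ 0) {x₀ : ℝ} (hx₀ : 0 < x₀) :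
    HasDerivAt (kernel c) (((-(Real.exp (-(Real.log x₀) ^ 2 / 4) / (2 * Real.sqrt π * x₀)) : ℝ) : ℂ)) x₀ := by
  -- work with the exponential form on the neighbourhood `(x₀/2, 3x₀/2)`
  set F : ℝ → ℝ → ℂ := fun x y =>
    cexp (((c : ℂ) + y * I) ^ 2) * cexp (-((c : ℂ) + y * I) * (Real.log x : ℂ)) / ((c : ℂ) + y * I) with hF
  set F' : ℝ → ℝ → ℂ := fun x y =>
    -(cexp (((c : ℂ) + y * I) ^ 2) * cexp (-((c : ℂ) + y * I) * (Real.log x : ℂ))) * (x : ℂ)⁻¹ with hF'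
  have hne : ∀ y : ℝ, (c : ℂ) + y * I ≠ 0 := fun y h => by
    have := congrArg Complex.re h; simp at this; exact hc this
  have hs : Ioo (x₀ / 2) (3 * x₀ / 2) ∈ 𝓝 x₀ := Ioo_mem_nhds (by linarith) (by linarith)
  have hpos : ∀ x ∈ Ioo (x₀ / 2) (3 * x₀ / 2), 0 < x := fun x hx => by linarith [hx.1]
  -- measurability and integrability
  have hFcont : ∀ x, 0 < x → Continuous (F x) := by
    intro x hx
    simp only [hF]
    exact Continuous.div (by fun_prop) (by fun_prop) hne
  have hF_meas : ∀ᶠ x in 𝓝 x₀, AEStronglyMeasurable (F x) volume :=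
    Filter.eventually_of_mem hs fun x hx => (hFcont x (hpos x hx)).aestronglyMeasurable
  have hF_int : Integrable (F x₀) volume := by
    have h := integrable_kernelIntegrand hc hx₀
    refine h.congr (Eventually.of_forall fun y => ?_)
    exact kernelIntegrand_eq_exp hx₀ y
  have hF'cont : Continuous (F' x₀) := by simp only [hF']; fun_prop
  -- the dominating function
  set p : ℝ := -c - 1 with hp
  set B : ℝ := Real.exp (c ^ 2) * ((x₀ / 2) ^ p + (3 * x₀ / 2) ^ p) with hB
  have hxp : ∀ x ∈ Ioo (x₀ / 2) (3 * x₀ / 2), x ^ p ≤ (x₀ / 2) ^ p + (3 * x₀ / 2) ^ p := by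
    intro x hx
    have h1 : 0 ≤ (x₀ / 2) ^ p := Real.rpow_nonneg (by linarith) _
    have h2 : 0 ≤ (3 * x₀ / 2) ^ p := Real.rpow_nonneg (by linarith) _
    rcases le_or_gt 0 p with hp0 | hp0
    · have := Real.rpow_le_rpow (hpos x hx).le hx.2.le hp0
      linarith
    · have := Real.rpow_le_rpow_of_nonpos (by linarith) hx.1.le hp0.le
      linarith
  have h_bound : ∀ᵐ y : ℝ, ∀ x ∈ Ioo (x₀ / 2) (3 * x₀ / 2), ‖F' x y‖ ≤ B * Real.exp (-1 * y ^ 2) := by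
    refine Eventually.of_forall fun y x hx => ?_
    have hx0 := hpos x hx
    simp only [hF']
    rw [norm_mul, norm_neg, norm_mul, norm_cexp_sq, ← ofReal_cpow_neg x hx0, norm_cpow_neg c y hx0,
      norm_inv, Complex.norm_real, Real.norm_of_nonneg hx0.le]
    have e : Real.exp (c ^ 2 - y ^ 2) * x ^ (-c) * x⁻¹ = Real.exp (c ^ 2) * x ^ p * Real.exp (-1 * y ^ 2) := by
      rw [Real.exp_sub, hp, show -c - 1 = -c + (-1 : ℝ) by ring, Real.rpow_add hx0, Real.rpow_neg_one,
        show (-1 : ℝ) * y ^ 2 = -(y ^ 2) by ring, Real.exp_neg]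
      field_simp
    rw [e, hB]
    have := hxp x hx
    have h3 : 0 ≤ Real.exp (c ^ 2) * Real.exp (-1 * y ^ 2) := by positivity
    nlinarith
  have bound_integrable : Integrable (fun y : ℝ => B * Real.exp (-1 * y ^ 2)) volume :=
    (integrable_exp_neg_mul_sq zero_lt_one).const_mul B
  -- the pointwise derivative
  have h_diff : ∀ᵐ y : ℝ, ∀ x ∈ Ioo (x₀ / 2) (3 * x₀ / 2), HasDerivAt (F · y) (F' x y) x := by
    refine Eventually.of_forall fun y x hx => ?_
    have hx0 := hpos x hx
    simp only [hF, hF']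
    have hlog : HasDerivAt (fun x : ℝ => (Real.log x : ℂ)) ((x : ℂ)⁻¹) x := by
      have h := (Real.hasDerivAt_log hx0.ne').ofReal_comp
      simpa using h
    have h1 : HasDerivAt (fun x : ℝ => cexp (-((c : ℂ) + y * I) * (Real.log x : ℂ)))
        (cexp (-((c : ℂ) + y * I) * (Real.log x : ℂ)) * (-((c : ℂ) + y * I) * (x : ℂ)⁻¹)) x :=
      (hlog.const_mul _).cexp
    have h2 := ((h1.const_mul (cexp (((c : ℂ) + y * I) ^ 2))).div_const ((c : ℂ) + y * I))
    refine h2.congr_deriv ?_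
    field_simp [hne y]
  obtain ⟨_, hderiv⟩ := hasDerivAt_integral_of_dominated_loc_of_deriv_le hs hF_meas hF_int
    hF'cont.aestronglyMeasurable h_bound bound_integrable h_diff
  -- the value of `∫ F' x₀`
  have hval : ∫ y : ℝ, F' x₀ y = -((x₀ : ℂ)⁻¹) *
      ((Real.sqrt π * Real.exp (-(Real.log x₀) ^ 2 / 4) : ℝ) : ℂ) := by
    rw [← integral_cexp_sq_mul_cpow_neg c hx₀, ← integral_const_mul]
    refine integral_congr_ae (Eventually.of_forall fun y => ?_)
    simp only [hF']
    rw [ofReal_cpow_neg x₀ hx₀]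
    ring
  -- `kernel c = (1/2π) ∫ F` near `x₀`
  have hK : kernel c =ᶠ[𝓝 x₀] fun x => (1 / (2 * π) : ℂ) * ∫ y : ℝ, F x y := by
    refine Filter.eventually_of_mem hs fun x hx => ?_
    rw [kernel]
    congr 1
    refine integral_congr_ae (Eventually.of_forall fun y => ?_)
    exact kernelIntegrand_eq_exp (hpos x hx) y
  refine HasDerivAt.congr_of_eventuallyEq ?_ hK
  have h := hderiv.const_mul (1 / (2 * π) : ℂ)
  rw [hval] at h
  refine h.congr_deriv ?_
  have hsπ : ((Real.sqrt π : ℝ) : ℂ) ≠ 0 := by exact_mod_cast (Real.sqrt_pos.2 Real.pi_pos).ne'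
  have hx0' : (x₀ : ℂ) ≠ 0 := by exact_mod_cast hx₀.ne'
  have hππ : (π : ℂ) = ((Real.sqrt π : ℝ) : ℂ) * (Real.sqrt π : ℝ) := by
    rw [← Complex.ofReal_mul, Real.mul_self_sqrt Real.pi_pos.le]
  rw [hππ]
  push_cast
  field_simp

/-! ### The Gaussian cutoff `W(x) = ½ erfc(½ log x)` -/

/-- **The Gaussian cutoff** `W(x) = ½ − (1/(2√π)) ∫₀^{log x} e^{−τ²/4} dτ`
`= (1/(2√π)) ∫_{log x}^{∞} e^{−τ²/4} dτ = ½ erfc(½ log x)`. [folklore] -/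
def gaussCutoff (x : ℝ) : ℝ :=
  1 / 2 - 1 / (2 * Real.sqrt π) * ∫ τ in (0 : ℝ)..Real.log x, Real.exp (-τ ^ 2 / 4)

/-- `W(1) = ½`. [folklore] -/
theorem gaussCutoff_one : gaussCutoff 1 = 1 / 2 := by simp [gaussCutoff]

/-- `W(x) + W(1/x) = 1` (the integrand is even). [folklore] -/
theorem gaussCutoff_add_gaussCutoff_inv (x : ℝ) : gaussCutoff x + gaussCutoff x⁻¹ = 1 := by
  simp only [gaussCutoff, Real.log_inv]
  have h : ∫ τ in (0 : ℝ)..-Real.log x, Real.exp (-τ ^ 2 / 4) =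
      -∫ τ in (0 : ℝ)..Real.log x, Real.exp (-τ ^ 2 / 4) := by
    calc ∫ τ in (0 : ℝ)..-Real.log x, Real.exp (-τ ^ 2 / 4)
        = ∫ τ in (0 : ℝ)..-Real.log x, Real.exp (-(-τ) ^ 2 / 4) := by
          congr 1; funext τ; ring_nf
      _ = ∫ τ in Real.log x..0, Real.exp (-τ ^ 2 / 4) := by
          rw [intervalIntegral.integral_comp_neg (fun τ => Real.exp (-τ ^ 2 / 4))]
          simp
      _ = -∫ τ in (0 : ℝ)..Real.log x, Real.exp (-τ ^ 2 / 4) := intervalIntegral.integral_symm _ _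
  rw [h]
  ring

/-- `W'(x) = −e^{−(log x)²/4}/(2√π x)` for `x > 0`. [folklore] -/
theorem hasDerivAt_gaussCutoff {x : ℝ} (hx : 0 < x) :
    HasDerivAt gaussCutoff (-(Real.exp (-(Real.log x) ^ 2 / 4) / (2 * Real.sqrt π * x))) x := by
  have hcont : Continuous fun τ : ℝ => Real.exp (-τ ^ 2 / 4) := by fun_prop
  have h1 : HasDerivAt (fun ℓ : ℝ => ∫ τ in (0 : ℝ)..ℓ, Real.exp (-τ ^ 2 / 4))
      (Real.exp (-(Real.log x) ^ 2 / 4)) (Real.log x) :=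
    intervalIntegral.integral_hasDerivAt_right (hcont.intervalIntegrable _ _)
      (hcont.stronglyMeasurableAtFilter _ _) hcont.continuousAt
  have h2 := h1.comp x (Real.hasDerivAt_log hx.ne')
  have h3 := (h2.const_mul (1 / (2 * Real.sqrt π))).const_sub (1 / 2 : ℝ)
  refine h3.congr_deriv ?_
  have hs : 0 < Real.sqrt π := Real.sqrt_pos.2 Real.pi_pos
  field_simp

/-- `∫₀^∞ e^{−τ²/4} dτ = √π`. [folklore] -/
theorem integral_Ioi_exp_neg_sq_div_four : ∫ τ in Ioi (0 : ℝ), Real.exp (-τ ^ 2 / 4) = Real.sqrt π := by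
  have h := integral_gaussian_Ioi (1 / 4)
  have e : (fun τ : ℝ => Real.exp (-(1 / 4) * τ ^ 2)) = fun τ => Real.exp (-τ ^ 2 / 4) := by
    funext τ; ring_nf
  rw [e] at h
  rw [h, show π / (1 / 4) = (2 : ℝ) ^ 2 * π by ring, Real.sqrt_mul' _ Real.pi_pos.le,
    Real.sqrt_sq (by norm_num)]
  ring

/-- `W(x) → 0` as `x → ∞`. [folklore] -/
theorem tendsto_gaussCutoff_atTop : Tendsto gaussCutoff atTop (𝓝 0) := by
  have hcont : Continuous fun τ : ℝ => Real.exp (-τ ^ 2 / 4) := by fun_prop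
  have hint : IntegrableOn (fun τ : ℝ => Real.exp (-τ ^ 2 / 4)) (Ioi 0) := by
    have h := (integrable_exp_neg_mul_sq (by norm_num : (0 : ℝ) < 1 / 4)).integrableOn (s := Ioi 0)
    refine h.congr_fun (fun τ _ => by ring_nf) measurableSet_Ioi
  have h1 : Tendsto (fun ℓ : ℝ => ∫ τ in (0 : ℝ)..ℓ, Real.exp (-τ ^ 2 / 4)) atTop
      (𝓝 (∫ τ in Ioi (0 : ℝ), Real.exp (-τ ^ 2 / 4))) :=
    intervalIntegral_tendsto_integral_Ioi 0 hint tendsto_id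
  rw [integral_Ioi_exp_neg_sq_div_four] at h1
  have h2 := h1.comp Real.tendsto_log_atTop
  have h3 := (h2.const_mul (1 / (2 * Real.sqrt π))).const_sub (1 / 2 : ℝ)
  have hs : 0 < Real.sqrt π := Real.sqrt_pos.2 Real.pi_pos
  have hval : (1 / 2 : ℝ) - 1 / (2 * Real.sqrt π) * Real.sqrt π = 0 := by field_simp; ring
  rw [hval] at h3
  exact h3

/-- `W(x) → 1` as `x → 0⁺`. [folklore] -/
theorem tendsto_gaussCutoff_nhdsWithin_zero : Tendsto gaussCutoff (𝓝[>] 0) (𝓝 1) := by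
  have h : Tendsto (fun x : ℝ => 1 - gaussCutoff x⁻¹) (𝓝[>] 0) (𝓝 (1 - 0)) :=
    (tendsto_gaussCutoff_atTop.comp tendsto_inv_nhdsGT_zero).const_sub 1
  rw [sub_zero] at h
  refine h.congr' ?_
  filter_upwards [self_mem_nhdsWithin] with x hx
  have := gaussCutoff_add_gaussCutoff_inv x
  linarith

/-! ### Identification of the kernel with the cutoff -/

/-- For `c > 0`: **`K_c(x) = W(x)`** (`x > 0`): both have the same derivative on `(0, ∞)` and tend
to `0` at `+∞`. [folklore] -/
theorem kernel_eq_gaussCutoff {c : ℝ} (hc : 0 < c) {x : ℝ} (hx : 0 < x) :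
    kernel c x = (gaussCutoff x : ℂ) := by
  -- `g = K_c − W` is locally constant on `(0, ∞)`
  set g : ℝ → ℂ := fun x => kernel c x - (gaussCutoff x : ℂ) with hg
  have hgd : ∀ x, 0 < x → HasDerivAt g 0 x := by
    intro x hx
    have h1 := hasDerivAt_kernel hc.ne' hx
    have h2 := (hasDerivAt_gaussCutoff hx).ofReal_comp
    have h : HasDerivAt g _ x := h1.sub h2
    rwa [sub_self] at h
  have hconst : ∀ x y : ℝ, 0 < x → 0 < y → g x = g y := by
    intro x y hx hy
    refine IsOpen.is_const_of_deriv_eq_zero isOpen_Ioi isPreconnected_Ioi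
      (fun z hz => (hgd z hz).differentiableAt.differentiableWithinAt)
      (fun z hz => (hgd z hz).deriv) hx hy
  -- and tends to `0` at `+∞`
  have hlim : Tendsto g atTop (𝓝 0) := by
    have hK : Tendsto (fun x => kernel c x) atTop (𝓝 0) := by
      rw [tendsto_zero_iff_norm_tendsto_zero]
      have hbound : ∀ᶠ x in atTop, ‖kernel c x‖ ≤ Real.exp (c ^ 2) / (2 * Real.sqrt π * |c|) * x ^ (-c) := by
        filter_upwards [eventually_gt_atTop 0] with x hx using norm_kernel_le hc.ne' hx
      have hpow : Tendsto (fun x : ℝ => Real.exp (c ^ 2) / (2 * Real.sqrt π * |c|) * x ^ (-c)) atTop (𝓝 0) := by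
        simpa using (tendsto_rpow_neg_atTop hc).const_mul (Real.exp (c ^ 2) / (2 * Real.sqrt π * |c|))
      exact squeeze_zero' (Eventually.of_forall fun x => norm_nonneg _) hbound hpow
    have hW : Tendsto (fun x => ((gaussCutoff x : ℝ) : ℂ)) atTop (𝓝 0) := by
      have := (Complex.continuous_ofReal.tendsto 0).comp tendsto_gaussCutoff_atTop
      rw [Complex.ofReal_zero] at this
      exact this
    have := hK.sub hW
    simpa [hg] using this
  -- hence `g ≡ 0`
  have hgx : g x = 0 := by
    have hev : ∀ᶠ y in atTop, g y = g x := by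
      filter_upwards [eventually_gt_atTop 0] with y hy using hconst y x hy hx
    have h2 : Tendsto (fun _ : ℝ => g x) atTop (𝓝 0) := hlim.congr' hev
    exact tendsto_nhds_unique tendsto_const_nhds h2
  have : kernel c x - (gaussCutoff x : ℂ) = 0 := hgx
  exact sub_eq_zero.1 this

/-- For `c < 0`: **`K_c(x) = W(x) − 1`** (`x > 0`): same derivative, and both sides tend to `0` as
`x → 0⁺`. So the lines `Re u = c > 0` and `Re u = c' < 0` differ by the residue `1` at `u = 0`.
[folklore] -/
theorem kernel_eq_gaussCutoff_sub_one {c : ℝ} (hc : c < 0) {x : ℝ} (hx : 0 < x) :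
    kernel c x = (gaussCutoff x : ℂ) - 1 := by
  set g : ℝ → ℂ := fun x => kernel c x - ((gaussCutoff x : ℂ) - 1) with hg
  have hgd : ∀ x, 0 < x → HasDerivAt g 0 x := by
    intro x hx
    have h1 := hasDerivAt_kernel hc.ne hx
    have h2 := ((hasDerivAt_gaussCutoff hx).ofReal_comp).sub_const (1 : ℂ)
    have h : HasDerivAt g _ x := h1.sub h2
    rwa [sub_self] at h
  have hconst : ∀ x y : ℝ, 0 < x → 0 < y → g x = g y := by
    intro x y hx hy
    refine IsOpen.is_const_of_deriv_eq_zero isOpen_Ioi isPreconnected_Ioi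
      (fun z hz => (hgd z hz).differentiableAt.differentiableWithinAt)
      (fun z hz => (hgd z hz).deriv) hx hy
  have hlim : Tendsto g (𝓝[>] 0) (𝓝 0) := by
    have hK : Tendsto (fun x => kernel c x) (𝓝[>] 0) (𝓝 0) := by
      rw [tendsto_zero_iff_norm_tendsto_zero]
      have hbound : ∀ᶠ x in 𝓝[>] (0 : ℝ), ‖kernel c x‖ ≤ Real.exp (c ^ 2) / (2 * Real.sqrt π * |c|) * x ^ (-c) := by
        filter_upwards [self_mem_nhdsWithin] with x hx using norm_kernel_le hc.ne (mem_Ioi.1 hx)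
      have hpow : Tendsto (fun x : ℝ => Real.exp (c ^ 2) / (2 * Real.sqrt π * |c|) * x ^ (-c)) (𝓝[>] 0) (𝓝 0) := by
        have h0 : Tendsto (fun x : ℝ => x ^ (-c)) (𝓝[>] 0) (𝓝 0) := by
          have := (Real.continuousAt_rpow_const 0 (-c) (Or.inr (by linarith))).tendsto
          rw [Real.zero_rpow (by linarith)] at this
          exact this.mono_left nhdsWithin_le_nhds
        simpa using h0.const_mul (Real.exp (c ^ 2) / (2 * Real.sqrt π * |c|))
      exact squeeze_zero' (Eventually.of_forall fun x => norm_nonneg _) hbound hpow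
    have hW : Tendsto (fun x => ((gaussCutoff x : ℝ) : ℂ) - 1) (𝓝[>] 0) (𝓝 0) := by
      have h1 := (Complex.continuous_ofReal.tendsto 1).comp tendsto_gaussCutoff_nhdsWithin_zero
      have h2 := h1.sub_const (1 : ℂ)
      rw [Complex.ofReal_one, sub_self] at h2
      exact h2
    have := hK.sub hW
    simpa [hg] using this
  have hgx : g x = 0 := by
    have hev : ∀ᶠ y in 𝓝[>] (0 : ℝ), g y = g x := by
      filter_upwards [self_mem_nhdsWithin] with y hy using hconst y x (mem_Ioi.1 hy) hx
    have h2 : Tendsto (fun _ : ℝ => g x) (𝓝[>] (0 : ℝ)) (𝓝 0) := hlim.congr' hev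
    exact tendsto_nhds_unique tendsto_const_nhds h2
  have : kernel c x - ((gaussCutoff x : ℂ) - 1) = 0 := hgx
  exact sub_eq_zero.1 this

/-- **The residue at `u = 0`**: for `c' < 0 < c` and `x > 0`, `K_c(x) − K_{c'}(x) = 1`. [folklore] -/
theorem kernel_sub_kernel_eq_one {c c' : ℝ} (hc : 0 < c) (hc' : c' < 0) {x : ℝ} (hx : 0 < x) :
    kernel c x - kernel c' x = 1 := by
  rw [kernel_eq_gaussCutoff hc hx, kernel_eq_gaussCutoff_sub_one hc' hx]
  ring

/-! ### The cutoff as a Gaussian tail, and its decay -/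

/-- The Gaussian `e^{−τ²/4}` is integrable on `ℝ`. [folklore] -/
theorem integrable_exp_neg_sq_div_four : Integrable fun τ : ℝ => Real.exp (-τ ^ 2 / 4) := by
  have h := integrable_exp_neg_mul_sq (by norm_num : (0 : ℝ) < 1 / 4)
  exact h.congr (Eventually.of_forall fun τ => by simp only; ring_nf)

/-- `W(x) = (1/(2√π)) ∫_{log x}^{∞} e^{−τ²/4} dτ`. [folklore] -/
theorem gaussCutoff_eq_integral_Ioi (x : ℝ) :
    gaussCutoff x = 1 / (2 * Real.sqrt π) * ∫ τ in Ioi (Real.log x), Real.exp (-τ ^ 2 / 4) := by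
  have hint := integrable_exp_neg_sq_div_four
  have h := intervalIntegral.integral_Ioi_sub_Ioi' (f := fun τ : ℝ => Real.exp (-τ ^ 2 / 4))
    (a := 0) (b := Real.log x) hint.integrableOn hint.integrableOn
  rw [integral_Ioi_exp_neg_sq_div_four] at h
  rw [gaussCutoff, ← h]
  have hs : 0 < Real.sqrt π := Real.sqrt_pos.2 Real.pi_pos
  field_simp
  ring

/-- **Gaussian tail bound**: `∫_ℓ^∞ e^{−τ²/4} dτ ≤ √π e^{−ℓ²/4}` for `ℓ ≥ 0`
(`τ² ≥ ℓ² + (τ − ℓ)²` for `τ ≥ ℓ ≥ 0`). [folklore] -/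
theorem integral_Ioi_exp_neg_sq_div_four_le {ℓ : ℝ} (hℓ : 0 ≤ ℓ) :
    ∫ τ in Ioi ℓ, Real.exp (-τ ^ 2 / 4) ≤ Real.sqrt π * Real.exp (-ℓ ^ 2 / 4) := by
  have hint := integrable_exp_neg_sq_div_four
  -- pointwise comparison on `Ioi ℓ`
  have hpt : ∀ τ ∈ Ioi ℓ, Real.exp (-τ ^ 2 / 4) ≤ Real.exp (-ℓ ^ 2 / 4) * Real.exp (-(τ - ℓ) ^ 2 / 4) := by
    intro τ hτ
    rw [← Real.exp_add, Real.exp_le_exp]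
    have : 0 ≤ τ - ℓ := by linarith [mem_Ioi.1 hτ]
    nlinarith
  -- the translated Gaussian integrates to `√π`
  have hshift : ∫ τ in Ioi ℓ, Real.exp (-(τ - ℓ) ^ 2 / 4) = Real.sqrt π := by
    have hcont : Continuous fun τ : ℝ => Real.exp (-(τ - ℓ) ^ 2 / 4) := by fun_prop
    have hint' : Integrable fun τ : ℝ => Real.exp (-(τ - ℓ) ^ 2 / 4) :=
      hint.comp_sub_right ℓ
    have h1 : Tendsto (fun b : ℝ => ∫ τ in ℓ..b, Real.exp (-(τ - ℓ) ^ 2 / 4)) atTop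
        (𝓝 (∫ τ in Ioi ℓ, Real.exp (-(τ - ℓ) ^ 2 / 4))) :=
      intervalIntegral_tendsto_integral_Ioi ℓ hint'.integrableOn tendsto_id
    have h2 : Tendsto (fun b : ℝ => ∫ τ in ℓ..b, Real.exp (-(τ - ℓ) ^ 2 / 4)) atTop (𝓝 (Real.sqrt π)) := by
      have e : ∀ b : ℝ, ∫ τ in ℓ..b, Real.exp (-(τ - ℓ) ^ 2 / 4) = ∫ τ in (0 : ℝ)..(b - ℓ), Real.exp (-τ ^ 2 / 4) := by
        intro b
        rw [intervalIntegral.integral_comp_sub_right (fun τ => Real.exp (-τ ^ 2 / 4)) ℓ, sub_self]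
      simp_rw [e]
      rw [← integral_Ioi_exp_neg_sq_div_four]
      exact intervalIntegral_tendsto_integral_Ioi 0 hint.integrableOn (tendsto_atTop_add_const_right _ _ tendsto_id)
    exact tendsto_nhds_unique h1 h2
  calc ∫ τ in Ioi ℓ, Real.exp (-τ ^ 2 / 4)
      ≤ ∫ τ in Ioi ℓ, Real.exp (-ℓ ^ 2 / 4) * Real.exp (-(τ - ℓ) ^ 2 / 4) :=
        setIntegral_mono_on hint.integrableOn ((hint.comp_sub_right ℓ).integrableOn.const_mul _)
          measurableSet_Ioi hpt
    _ = Real.exp (-ℓ ^ 2 / 4) * Real.sqrt π := by rw [integral_const_mul, hshift]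
    _ = Real.sqrt π * Real.exp (-ℓ ^ 2 / 4) := mul_comm _ _

/-- **Decay for `x ≥ 1`**: `0 ≤ W(x) ≤ ½ e^{−(log x)²/4}`. [folklore] -/
theorem gaussCutoff_nonneg_le {x : ℝ} (hx : 1 ≤ x) :
    0 ≤ gaussCutoff x ∧ gaussCutoff x ≤ 1 / 2 * Real.exp (-(Real.log x) ^ 2 / 4) := by
  rw [gaussCutoff_eq_integral_Ioi]
  have hs : 0 < Real.sqrt π := Real.sqrt_pos.2 Real.pi_pos
  have hℓ : 0 ≤ Real.log x := Real.log_nonneg hx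
  refine ⟨mul_nonneg (by positivity) (setIntegral_nonneg measurableSet_Ioi fun τ _ => (Real.exp_pos _).le), ?_⟩
  have h := integral_Ioi_exp_neg_sq_div_four_le hℓ
  calc 1 / (2 * Real.sqrt π) * ∫ τ in Ioi (Real.log x), Real.exp (-τ ^ 2 / 4)
      ≤ 1 / (2 * Real.sqrt π) * (Real.sqrt π * Real.exp (-(Real.log x) ^ 2 / 4)) :=
        mul_le_mul_of_nonneg_left h (by positivity)
    _ = 1 / 2 * Real.exp (-(Real.log x) ^ 2 / 4) := by field_simp

/-- **Decay for `0 < x ≤ 1`**: `0 ≤ 1 − W(x) ≤ ½ e^{−(log x)²/4}`. [folklore] -/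
theorem one_sub_gaussCutoff_nonneg_le {x : ℝ} (hx0 : 0 < x) (hx : x ≤ 1) :
    0 ≤ 1 - gaussCutoff x ∧ 1 - gaussCutoff x ≤ 1 / 2 * Real.exp (-(Real.log x) ^ 2 / 4) := by
  have hsymm := gaussCutoff_add_gaussCutoff_inv (x := x)
  have hinv : 1 ≤ x⁻¹ := one_le_inv_iff₀.2 ⟨hx0, hx⟩
  have h := gaussCutoff_nonneg_le hinv
  rw [Real.log_inv, neg_sq] at h
  constructor <;> linarith [h.1, h.2]

/-- `0 ≤ W ≤ 1` on `(0, ∞)`. [folklore] -/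
theorem gaussCutoff_mem_Icc {x : ℝ} (hx : 0 < x) : gaussCutoff x ∈ Icc (0 : ℝ) 1 := by
  rcases le_or_gt 1 x with h | h
  · have h1 := gaussCutoff_nonneg_le h
    have h2 : Real.exp (-(Real.log x) ^ 2 / 4) ≤ 1 := Real.exp_le_one_iff.2 (by nlinarith [sq_nonneg (Real.log x)])
    exact ⟨h1.1, by linarith [h1.2]⟩
  · have h1 := one_sub_gaussCutoff_nonneg_le hx h.le
    have h2 : Real.exp (-(Real.log x) ^ 2 / 4) ≤ 1 := Real.exp_le_one_iff.2 (by nlinarith [sq_nonneg (Real.log x)])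
    exact ⟨by linarith [h1.2], by linarith [h1.1]⟩

/-- `e^{−ℓ²/4} ≤ e^{A²} e^{−Aℓ}` (`(ℓ/2 − A)² ≥ 0`). [folklore] -/
theorem exp_neg_sq_div_four_le (A ℓ : ℝ) : Real.exp (-ℓ ^ 2 / 4) ≤ Real.exp (A ^ 2) * Real.exp (-(A * ℓ)) := by
  rw [← Real.exp_add, Real.exp_le_exp]
  nlinarith [sq_nonneg (ℓ / 2 - A)]

/-- **Polynomial decay**: `W(x) ≤ ½ e^{A²} x^{−A}` for `x ≥ 1`, `A` real. [folklore] -/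
theorem gaussCutoff_le_rpow {x : ℝ} (hx : 1 ≤ x) (A : ℝ) :
    gaussCutoff x ≤ 1 / 2 * Real.exp (A ^ 2) * x ^ (-A) := by
  have h := (gaussCutoff_nonneg_le hx).2
  have hx0 : 0 < x := by linarith
  have he := exp_neg_sq_div_four_le A (Real.log x)
  rw [show -(A * Real.log x) = Real.log x * (-A) by ring, ← Real.rpow_def_of_pos hx0] at he
  calc gaussCutoff x ≤ 1 / 2 * Real.exp (-(Real.log x) ^ 2 / 4) := h
    _ ≤ 1 / 2 * (Real.exp (A ^ 2) * x ^ (-A)) := by gcongr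
    _ = _ := by ring

/-- **Polynomial approach to `1`**: `1 − W(x) ≤ ½ e^{A²} x^{A}` for `0 < x ≤ 1`, `A` real. [folklore] -/
theorem one_sub_gaussCutoff_le_rpow {x : ℝ} (hx0 : 0 < x) (hx : x ≤ 1) (A : ℝ) :
    1 - gaussCutoff x ≤ 1 / 2 * Real.exp (A ^ 2) * x ^ A := by
  have h := (one_sub_gaussCutoff_nonneg_le hx0 hx).2
  have he := exp_neg_sq_div_four_le (-A) (Real.log x)
  rw [neg_sq, show -(-A * Real.log x) = Real.log x * A by ring, ← Real.rpow_def_of_pos hx0] at he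
  calc 1 - gaussCutoff x ≤ 1 / 2 * Real.exp (-(Real.log x) ^ 2 / 4) := h
    _ ≤ 1 / 2 * (Real.exp (A ^ 2) * x ^ A) := by gcongr
    _ = _ := by ring

end GaussMellin

end Literature.Analysis.SpecialFunctions
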